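import Literature.MathematicalPhysics.QuantumLattice.HubbardGaugeBoundSharp
import Literature.MathematicalPhysics.QuantumLattice.HubbardNNNHopping
import HarnessLib

/-!
# Koma–Tasaki's a priori bound for two hopping graphs (the `t–t'` Hubbard model)

Trunk T-QLATTICE (family `hubbard`; consumer: the machine-checked Koma–Tasaki `η`-line of the
`t–t'` Hubbard model, `Summits/HubbardSuperconductivity/HubbardLadder/Bounds/PairCorrelationEtaLineDipoleTPrime.lean`).

Koma–Tasaki's complex-gauge bound (PRL 68 (1992) 3248, eqs. (5)–(12)) is linear in the hopping
term: note 9 of the paper records that the theorem covers any finite-range hopping, the perturbation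
of eq. (11) being `‖U‖ ≤ Σ_{x,y} |t_{xy}| (cosh(φ_x - φ_y) - 1)`. For the `t–t'` model on the square
torus (`HubbardNNNHopping.hubbardTorusTT'`: nearest-neighbour amplitude `t` on `torusGraph`, diagonal
amplitude `t'` on `torusDiagGraph`) this file records

* `norm_thermalCorr_pair_le_exp_two_graphs` — for `H = (H_{G₁}(t₁,U₁) - μ₁N) + (H_{G₂}(t₂,U₂) - μ₂N)`
  on any two symmetric graphs over the same sites, every real `φ` and `β ≥ 0`:
  `|⟨c†_{x↑} c†_{x↓} c_{y↓} c_{y↑}⟩_β| ≤ e^{-2(φ_x - φ_y)} exp[β (|t₁| Σ_{G₁} + |t₂| Σ_{G₂}) (cosh(φ_u - φ_v) - 1)]`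
  with Koma–Tasaki's printed hopping norm `‖c†_u c_v + c†_v c_u‖ ≤ 1` (`HubbardGaugeBoundSharp`);
* `hubbardTorusTT'_sub_chemicalPotential` — `H_{t,t'}(U) - μN` is such a sum
  (`G₁` = nearest-neighbour, `G₂` = diagonal fermionic torus graph);
* `norm_thermalCorr_pair_le_exp_tt'` — the a priori bound for the grand-canonical `t–t'` model.

Sources: T. Koma, H. Tasaki, PRL 68 (1992) 3248, eqs. (5)–(12) and note 9; H. Xu et al.,
Science 384 (2024) eadh7691, eq. (1) (the `t–t'` Hamiltonian).

## Mathlib search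

Nothing model-specific in Mathlib; the gauge machinery is the tree's (`HubbardGaugeBound`:
`siteGauge`, `hoppingForm`, `siteGauge_conj_hamiltonianWith_add_conjTranspose`;
`HubbardHubbardModelPairDecayProofs.norm_gibbsState_le_of_gauge`;
`HubbardGaugeBoundSharp.norm_hoppingPerturbation_le_sharp`).
-/

noncomputable section

namespace Literature.MathematicalPhysics.QuantumLattice

open Matrix Finset NormedSpace HubbardWave0
open scoped Matrix.Norms.L2Operator ComplexOrder

/-! ### Two hopping graphs on the same sites -/

section TwoGraphs

variable {Λ : Type*} [LinearOrder Λ] [Fintype Λ]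
  (G₁ : SimpleGraph Λ) [DecidableRel G₁.Adj] (G₂ : SimpleGraph Λ) [DecidableRel G₂.Adj]

/-- **Koma–Tasaki's a priori bound for a two-graph hopping** (eqs. (6)–(12) before the choice of
`φ`, with the printed hopping norm of eq. (11) and the finite-range remark of note 9): for
`H = (H_{G₁}(t₁,U₁) - μ₁N) + (H_{G₂}(t₂,U₂) - μ₂N)`, every real site function `φ` and `β ≥ 0`,
`|⟨c†_{x↑} c†_{x↓} c_{y↓} c_{y↑}⟩_β| ≤ e^{-2(φ_x - φ_y)} exp[β (|t₁| Σ_u Σ_v [u ∼₁ v] + |t₂| Σ_u Σ_v [u ∼₂ v]) (cosh(φ_u - φ_v) - 1)]`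
(the gauge transformation acts summand-wise; the Hermitian perturbations add and so do their norm
bounds). Koma–Tasaki, PRL 68 (1992) 3248, eqs. (6)–(12), note 9.
[cite: KomaTasakiPRL1992, eqs. (6)–(12) and note 9] -/
theorem norm_thermalCorr_pair_le_exp_two_graphs (t₁ U₁ μ₁ t₂ U₂ μ₂ : ℝ) {β : ℝ} (hβ : 0 ≤ β)
    (φ : Λ → ℝ) (x y : Λ) :
    ‖(hamiltonianWith G₁ t₁ U₁ μ₁ + hamiltonianWith G₂ t₂ U₂ μ₂).thermalCorr β
        (creation (orb x 0) * creation (orb x 1))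
        (annihilation (orb y 1) * annihilation (orb y 0))‖ ≤
      Real.exp (-2 * (φ x - φ y)) *
        Real.exp (β * (|t₁| * (∑ u : Λ, ∑ v : Λ,
            if G₁.Adj u v then (Real.cosh (φ u - φ v) - 1) else 0) +
          |t₂| * ∑ u : Λ, ∑ v : Λ,
            if G₂.Adj u v then (Real.cosh (φ u - φ v) - 1) else 0)) := by
  have h1 := siteGauge_conj_hamiltonianWith_add_conjTranspose G₁ φ t₁ U₁ μ₁
  have h2 := siteGauge_conj_hamiltonianWith_add_conjTranspose G₂ φ t₂ U₂ μ₂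
  set H₁ : Matrix (Finset (Orb Λ)) (Finset (Orb Λ)) ℂ := hamiltonianWith G₁ t₁ U₁ μ₁ with hH₁
  set H₂ : Matrix (Finset (Orb Λ)) (Finset (Orb Λ)) ℂ := hamiltonianWith G₂ t₂ U₂ μ₂ with hH₂
  set V₁ : Matrix (Finset (Orb Λ)) (Finset (Orb Λ)) ℂ :=
    -(t₁ : ℂ) • hoppingForm G₁ (fun u v => Real.cosh (φ u - φ v) - 1) with hV₁
  set V₂ : Matrix (Finset (Orb Λ)) (Finset (Orb Λ)) ℂ :=
    -(t₂ : ℂ) • hoppingForm G₂ (fun u v => Real.cosh (φ u - φ v) - 1) with hV₂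
  set A : Matrix (Finset (Orb Λ)) (Finset (Orb Λ)) ℂ :=
    creation (orb x 0) * creation (orb x 1) * (annihilation (orb y 1) * annihilation (orb y 0))
    with hA_def
  set c : ℝ := |t₁| * (∑ u : Λ, ∑ v : Λ,
      if G₁.Adj u v then (Real.cosh (φ u - φ v) - 1) else 0) +
    |t₂| * ∑ u : Λ, ∑ v : Λ, if G₂.Adj u v then (Real.cosh (φ u - φ v) - 1) else 0 with hc_def
  have hH : (H₁ + H₂).IsHermitian :=
    (isHermitian_hamiltonianWith G₁ t₁ U₁ μ₁).add (isHermitian_hamiltonianWith G₂ t₂ U₂ μ₂)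
  have hD : IsUnit (siteGauge φ) := isUnit_siteGauge φ
  have hA : siteGauge φ * A * (siteGauge φ)⁻¹ =
      ((Real.exp (-2 * (φ x - φ y)) : ℝ) : ℂ) • A := by
    rw [siteGauge_inv]
    exact siteGauge_mul_pair_mul φ x y
  have hV : siteGauge φ * (H₁ + H₂) * (siteGauge φ)⁻¹ +
      (siteGauge φ * (H₁ + H₂) * (siteGauge φ)⁻¹)ᴴ = (2 : ℂ) • ((H₁ + H₂) + (V₁ + V₂)) := by
    rw [siteGauge_inv, Matrix.mul_add, Matrix.add_mul, conjTranspose_add]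
    calc siteGauge φ * H₁ * siteGauge (-φ) + siteGauge φ * H₂ * siteGauge (-φ) +
          ((siteGauge φ * H₁ * siteGauge (-φ))ᴴ + (siteGauge φ * H₂ * siteGauge (-φ))ᴴ)
        = (siteGauge φ * H₁ * siteGauge (-φ) + (siteGauge φ * H₁ * siteGauge (-φ))ᴴ) +
          (siteGauge φ * H₂ * siteGauge (-φ) + (siteGauge φ * H₂ * siteGauge (-φ))ᴴ) := by abel
      _ = (2 : ℂ) • (H₁ + V₁) + (2 : ℂ) • (H₂ + V₂) := by rw [h1, h2]
      _ = (2 : ℂ) • ((H₁ + H₂) + (V₁ + V₂)) := by module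
  have hc : ‖V₁ + V₂‖ ≤ c :=
    (norm_add_le _ _).trans (add_le_add (norm_hoppingPerturbation_le_sharp G₁ φ t₁)
      (norm_hoppingPerturbation_le_sharp G₂ φ t₂))
  have h := norm_gibbsState_le_of_gauge hH hD hA hV hc hβ
  have hκ : ‖((Real.exp (-2 * (φ x - φ y)) : ℝ) : ℂ)‖ = Real.exp (-2 * (φ x - φ y)) := by
    rw [Complex.norm_real, Real.norm_of_nonneg (Real.exp_pos _).le]
  have hthermal : (H₁ + H₂).thermalCorr β (creation (orb x 0) * creation (orb x 1))
      (annihilation (orb y 1) * annihilation (orb y 0)) = gibbsState β (H₁ + H₂) A := rfl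
  rw [hthermal]
  calc ‖gibbsState β (H₁ + H₂) A‖
      ≤ ‖((Real.exp (-2 * (φ x - φ y)) : ℝ) : ℂ)‖ * ‖A‖ * Real.exp (β * c) := h
    _ ≤ ‖((Real.exp (-2 * (φ x - φ y)) : ℝ) : ℂ)‖ * 1 * Real.exp (β * c) := by
        gcongr
        exact norm_pair_le_one x y
    _ = Real.exp (-2 * (φ x - φ y)) * Real.exp (β * c) := by rw [hκ, mul_one]

end TwoGraphs

/-! ### The `t–t'` Hubbard model on the square torus -/

/-- The grand-canonical `t–t'` Hamiltonian is the sum of the grand-canonical nearest-neighbour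
Hubbard Hamiltonian and the pure diagonal hopping:
`H_{t,t'}(U) - μN = (H_{n.n.}(t,U) - μN) + (H_{diag}(t',0) - 0·N)`.
Xu et al., Science 384 (2024) eadh7691, eq. (1). [cite: XuEtAl2024, eq. (1)] -/
theorem hubbardTorusTT'_sub_chemicalPotential (L : ℕ) (t t' U μ : ℝ) :
    hubbardTorusTT' L t t' U - (μ : ℂ) • totalNumber =
      hamiltonianWith (fermionTorusGraph 2 L) t U μ +
        hamiltonianWith (fermionTorusDiagGraph L) t' 0 0 := by
  simp only [hubbardTorusTT', hamiltonianWith, Complex.ofReal_zero, zero_smul, sub_zero]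
  abel

/-- **Koma–Tasaki's a priori bound for the grand-canonical `t–t'` Hubbard model** on `(ℤ/Lℤ)²`
(printed hopping norm): for all real `t, t', U, μ`, every real `φ` on the fermionic torus and
`β ≥ 0`,
`|⟨c†_{x↑} c†_{x↓} c_{y↓} c_{y↑}⟩_β| ≤ e^{-2(φ_x - φ_y)} exp[β (|t| Σ_{n.n.} + |t'| Σ_{diag}) (cosh(φ_u - φ_v) - 1)]`
(sums over ordered adjacent pairs). Koma–Tasaki, PRL 68 (1992) 3248, eqs. (6)–(12), note 9.
[cite: KomaTasakiPRL1992, eqs. (6)–(12) and note 9] -/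
theorem norm_thermalCorr_pair_le_exp_tt' (L : ℕ) (t t' U μ : ℝ) {β : ℝ} (hβ : 0 ≤ β)
    (φ : FermionTorus 2 L → ℝ) (x y : FermionTorus 2 L) :
    ‖(hubbardTorusTT' L t t' U - (μ : ℂ) • totalNumber).thermalCorr β
        (creation (orb x 0) * creation (orb x 1))
        (annihilation (orb y 1) * annihilation (orb y 0))‖ ≤
      Real.exp (-2 * (φ x - φ y)) *
        Real.exp (β * (|t| * (∑ u : FermionTorus 2 L, ∑ v : FermionTorus 2 L,
            if (fermionTorusGraph 2 L).Adj u v then (Real.cosh (φ u - φ v) - 1) else 0) +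
          |t'| * ∑ u : FermionTorus 2 L, ∑ v : FermionTorus 2 L,
            if (fermionTorusDiagGraph L).Adj u v then (Real.cosh (φ u - φ v) - 1) else 0)) := by
  have key := norm_thermalCorr_pair_le_exp_two_graphs (fermionTorusGraph 2 L)
    (fermionTorusDiagGraph L) t U μ t' 0 0 hβ φ x y
  rw [← hubbardTorusTT'_sub_chemicalPotential] at key
  refine Eq.trans_le ?_ (key.trans_eq ?_)
  · congr!
  · congr!

end Literature.MathematicalPhysics.QuantumLattice
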